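/-
Copyright (c) 2026 the pub-hodgecm-mathlib formalisation cell (harness21).  Prover seat hodgecm-mathlib-LH7-p06 (g3), req620 Track A «(D-RAM) FOUR-FRAME» squad
((β₂) road (R-36), the K6 road (K6-ROAD-BRIEF v1 dfa84314); β₂ sub-dealer LH4-p04 (g10) WORD #35 + #37 «LH7-p06: K6-(e)-0 THE ABSTRACT CORE ARITHMETIC» — the pure
`Finset`∕`ℤ` skeleton of MECH-K3 §4, the twin of ★ p862963 ∕ ★ p863898's abstract window reductions), 2026-09-05.
-/
import Mathlib.Algebra.BigOperators.Ring.Finset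
import Mathlib.Algebra.Order.BigOperators.Group.Finset
import Mathlib.Tactic.Ring
import HarnessLib

/-!
# Crux `H413`, line LH4 «(D-RAM) FOUR-FRAME» — (β₂) road, K6-(e)-0: «THE ABSTRACT CORE ARITHMETIC» — the row identity `Σ_cells X_H = Σ_cells X_A` from the per-cell law,
# ONE uniform density, the sign letter `p_A = −p_H`, and ONE vanishing digit sum (pure `Finset` algebra over `ℤ`)

Cell `hodgecm-mathlib` (D-0151), FLOOR 0, crux item H413 = `stmt-HodgeConjecture-24833`, route of record `HCCMUnconditional`; squad F0∕P3c∕LH4 (hand LH7-p06); lane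
`--supports stmt-HodgeConjecture-24833 --as helper` (count-neutral).  THEOREMS ONLY (no `def`, no instance, no notation, no `sorry`, default heartbeats); no lattice, no field:
generic index type `ι` (the consumer's `ℕ` with windows `range KH`, `range KA` of ★ p862963's `hcore`) and digit type `α` (the consumer's `E`).
WHY (MECH-K3 v1 `F0/P3c/LH4/LH4-p16/g2/MECH-K3.v1.LH4p16g2.md` §2–§4; β₂ WORD #35∕#37).  On the live row the cells are the shells of ONE digit `V`, the two literals `H`, `A` are the two
`Q`-classes of `V`, and per cell and literal the K6-0 law (LH4-p18 (g4) `…ConeCellPerCellLaw` HEAD′) reads `X_t(i)·#S_t(i) = n_t(i)·(p_t·Σ_{V ∈ S′_t(i)} ω V)` (`S_t(i)` the literal's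
digits in the cell, `S′_t(i) ⊆ S_t(i)` the labelled ones, `n_t` the weighted population, `p_t` the population sign).  With ‹K6-(f) UNIFORM DENSITY› — «the populated fibre over a
literal digit is ONE integer `k`, the same for every cell of the row and for both literals» (MECH-K3 §3's `ρ₀`; ★ `rowSize_diag` is its diagonal instance; a SEPARATE content piece,
NOT proved here) — the law becomes `X_t(i) = k·p_t·Σ_{S′_t(i)} ω` (§1), and summing over the two windows, with `p_A = −p_H` (MECH-K3 §2: `q_A = −q_H`, `p_A c_A = −p_H c_H`) and the
labelled digit sets of all listed cells of both literals PARTITIONING one digit set `B`, the row identity `Σ_{i ∈ I_H} X_H(i) = Σ_{i ∈ I_A} X_A(i)` is `k·p_H·Σ_{V ∈ B} ω V = 0` — the ONE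
arithmetic input «the ramified character sums to zero on `α₁(1 + 𝔭_F)`» (★ Lit `sum_normSign_repr_eq_zero` ∕ LH4-p14's sums at instantiation).  The A-window being cut short (the
anisotropic literal's far shells are EMPTY) is carried by the COVERING letter (every digit of `B` lies in a listed cell of its literal), not by a vanishing-sum hypothesis.
* §1 `cellValue_eq_mul_sum_of_mul_card` — per cell: K6-0 + ‹K6-(f)› + the empty-cell letter ⟹ `X = k·p·Σ_{S′} ω`;
* §2 `sum_biUnion_add_sum_biUnion_eq_sum` (the partition bookkeeping) and `sum_window_eq_sum_window_of_digit_partition` (FINSET FORM: explicit shells, explicit partition letters);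
* §2′ `sum_window_eq_sum_window_of_cellIndex` (DICTIONARY FORM: cells = fibres of a shell-index map `cell : α → ι`, literals = `Q` ∕ `¬Q` — K6-(d)'s «shell of `V` ↔ cell index»);
* §3 HEAD `sum_window_eq_sum_window_of_perCellLaw` — K6-0 currency end to end.
HONEST LABEL.  Arithmetic only; nothing printed is asserted; ‹CORE›, ‹K6-(f)›, β₂ stay HYPOTHESES; `HC_CM` is proved only modulo the 7 printed citations (2 remaining named inputs:
hLiu418 = `stmt-HodgeConjecture-24832`, h413 = `stmt-HodgeConjecture-24833`) until rung 0 closes.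
References: [Kottwitz1986BaseChangeUnits] §1 pp. 240–241 (cell-by-cell lattice bookkeeping) · [LabesseLanglands1979] §2 (2.2) p. 9 (κ-signed counts) · [Rogawski1990] §4.9 Prop. 4.9.1 (b) p. 55.
-/

set_option autoImplicit false

namespace Summit.HodgeConjecture.HodgeConjecture.Cruxes.H413.F0P3cDyRamCoreWindowOfDigitSums

open Finset

/-! ## §1 Per cell: the K6-0 law + uniform density ⟹ the signed count is `k·p·(labelled digit sum)` -/

/-- **PER-CELL ADAPTER.**  K6-0 in LH4-p18's HEAD′ currency `X·#S = n·(p·Σ_{V ∈ S′} ω V)` with `S′ ⊆ S` (counted literal digits `S`, summed labelled digits `S′`), the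
‹K6-(f) UNIFORM DENSITY› letter `n = k·#S`, and the empty-cell letter `n = 0 → X = 0` ⟹ `X = k·p·Σ_{V ∈ S′} ω V`.  (If `S = ∅` then `S′ = ∅`, `n = 0`, both sides vanish.)
[cite: Kottwitz1986BaseChangeUnits, §1 pp. 240–241] [cite: LabesseLanglands1979, §2 (2.2) p. 9] -/
theorem cellValue_eq_mul_sum_of_mul_card {α : Type*} (S S' : Finset α) (hS' : S' ⊆ S) (ω : α → ℤ) (X n p k : ℤ)
    (hmul : X * S.card = n * (p * ∑ V ∈ S', ω V)) (hk : n = k * S.card) (h0 : n = 0 → X = 0) :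
    X = k * p * ∑ V ∈ S', ω V := by
  by_cases hS : S.card = 0
  · have hSe : S = ∅ := card_eq_zero.1 hS
    have hS'e : S' = ∅ := subset_empty.1 (hSe ▸ hS')
    have hn : n = 0 := by rw [hk, hS]; simp
    rw [h0 hn, hS'e, sum_empty, mul_zero]
  · have hc : (S.card : ℤ) ≠ 0 := by exact_mod_cast hS
    rw [hk] at hmul
    have e : (X - k * p * ∑ V ∈ S', ω V) * S.card = 0 := by rw [sub_mul, hmul]; ring
    rcases mul_eq_zero.1 e with h | h
    · exact sub_eq_zero.1 h
    · exact absurd h hc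

/-! ## §2 The window identity — FINSET FORM (explicit shells and partition letters) -/

/-- **PARTITION BOOKKEEPING**: two indexed shell families `SH` on `IH` and `SA` on `IA`, each pairwise disjoint, mutually disjoint, all inside `B` and jointly covering `B` ⟹
`Σ_{i ∈ IH} Σ_{SH i} ω + Σ_{i ∈ IA} Σ_{SA i} ω = Σ_B ω`. [cite: Kottwitz1986BaseChangeUnits, §1 pp. 240–241] -/
theorem sum_biUnion_add_sum_biUnion_eq_sum {ι α : Type*} [DecidableEq α] (B : Finset α) (IH IA : Finset ι) (SH SA : ι → Finset α) (ω : α → ℤ)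
    (hHB : ∀ i ∈ IH, SH i ⊆ B) (hAB : ∀ i ∈ IA, SA i ⊆ B)
    (hdisjH : (IH : Set ι).PairwiseDisjoint SH) (hdisjA : (IA : Set ι).PairwiseDisjoint SA) (hdisjHA : ∀ i ∈ IH, ∀ i' ∈ IA, Disjoint (SH i) (SA i'))
    (hcov : ∀ V ∈ B, (∃ i ∈ IH, V ∈ SH i) ∨ (∃ i ∈ IA, V ∈ SA i)) :
    ∑ i ∈ IH, ∑ V ∈ SH i, ω V + ∑ i ∈ IA, ∑ V ∈ SA i, ω V = ∑ V ∈ B, ω V := by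
  rw [← sum_biUnion hdisjH, ← sum_biUnion hdisjA]
  have hdisjU : Disjoint (IH.biUnion SH) (IA.biUnion SA) := by
    rw [disjoint_biUnion_left]
    intro i hi
    rw [disjoint_biUnion_right]
    exact fun i' hi' => hdisjHA i hi i' hi'
  rw [← sum_union hdisjU]
  refine sum_congr ?_ fun _ _ => rfl
  ext V
  simp only [mem_union, mem_biUnion]
  constructor
  · rintro (⟨i, hi, hV⟩ | ⟨i, hi, hV⟩)
    · exact hHB i hi hV
    · exact hAB i hi hV
  · exact fun hV => hcov V hV

/-- **THE WINDOW IDENTITY, FINSET FORM.**  Two cell-value families `XH` on the window `IH` and `XA` on `IA` with `XH i = c·Σ_{SH i} ω`, `XA i = −c·Σ_{SA i} ω` (§1's output at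
`c = k·p_H`, `k·p_A = −k·p_H`), the shell families partitioning `B` as in `sum_biUnion_add_sum_biUnion_eq_sum` (the short A-window = the COVERING letter: every digit of `B` lies in
a listed cell of its literal), and `Σ_B ω = 0` ⟹ `Σ_{i ∈ IH} XH i = Σ_{i ∈ IA} XA i`. [cite: Kottwitz1986BaseChangeUnits, §1 pp. 240–241] [cite: Rogawski1990, §4.9 Prop. 4.9.1 (b) p. 55] -/
theorem sum_window_eq_sum_window_of_digit_partition {ι α : Type*} [DecidableEq α] (B : Finset α) (IH IA : Finset ι) (SH SA : ι → Finset α)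
    (XH XA : ι → ℤ) (ω : α → ℤ) (c : ℤ)
    (hXH : ∀ i ∈ IH, XH i = c * ∑ V ∈ SH i, ω V) (hXA : ∀ i ∈ IA, XA i = -c * ∑ V ∈ SA i, ω V)
    (hHB : ∀ i ∈ IH, SH i ⊆ B) (hAB : ∀ i ∈ IA, SA i ⊆ B)
    (hdisjH : (IH : Set ι).PairwiseDisjoint SH) (hdisjA : (IA : Set ι).PairwiseDisjoint SA) (hdisjHA : ∀ i ∈ IH, ∀ i' ∈ IA, Disjoint (SH i) (SA i'))
    (hcov : ∀ V ∈ B, (∃ i ∈ IH, V ∈ SH i) ∨ (∃ i ∈ IA, V ∈ SA i))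
    (hω : ∑ V ∈ B, ω V = 0) :
    ∑ i ∈ IH, XH i = ∑ i ∈ IA, XA i := by
  have hpart := sum_biUnion_add_sum_biUnion_eq_sum B IH IA SH SA ω hHB hAB hdisjH hdisjA hdisjHA hcov
  rw [hω] at hpart
  rw [sum_congr rfl hXH, sum_congr rfl hXA, ← mul_sum, ← mul_sum, neg_mul, ← sub_eq_zero, sub_neg_eq_add, ← mul_add, hpart, mul_zero]

/-! ## §2′ The window identity — DICTIONARY FORM (cells = fibres of the shell index, literals = the two `Q`-classes) -/

/-- **THE WINDOW IDENTITY, DICTIONARY FORM.**  A digit set `B`, a shell-index map `cell : α → ι` (K6-(d): «the shell of `V` is the cell index»), a literal class `Q` (literal `H`;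
literal `A` is `¬Q` — MECH-K3 §2 `q_A = −q_H`), windows `IH ⊇ cell(B ∩ Q)` and `IA ⊇ cell(B ∩ ¬Q)` (the anisotropic far shells are EMPTY: no `¬Q` digit points outside `IA`), cell
values `XH i = c·Σ_{V ∈ B, cell V = i, Q V} ω V`, `XA i = −c·Σ_{V ∈ B, cell V = i, ¬Q V} ω V`, and `Σ_B ω = 0` ⟹ `Σ_{i ∈ IH} XH i = Σ_{i ∈ IA} XA i`.
[cite: Kottwitz1986BaseChangeUnits, §1 pp. 240–241] [cite: Rogawski1990, §4.9 Prop. 4.9.1 (b) p. 55] -/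
theorem sum_window_eq_sum_window_of_cellIndex {ι α : Type*} [DecidableEq ι] (B : Finset α) (cell : α → ι) (Q : α → Prop) [DecidablePred Q] (IH IA : Finset ι)
    (XH XA : ι → ℤ) (ω : α → ℤ) (c : ℤ)
    (hwinH : ∀ V ∈ B, Q V → cell V ∈ IH) (hwinA : ∀ V ∈ B, ¬ Q V → cell V ∈ IA)
    (hXH : ∀ i ∈ IH, XH i = c * ∑ V ∈ B.filter (fun V => cell V = i ∧ Q V), ω V)
    (hXA : ∀ i ∈ IA, XA i = -c * ∑ V ∈ B.filter (fun V => cell V = i ∧ ¬ Q V), ω V)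
    (hω : ∑ V ∈ B, ω V = 0) :
    ∑ i ∈ IH, XH i = ∑ i ∈ IA, XA i := by
  classical
  -- the `Q`-digits summed over the H-window, the `¬Q`-digits over the A-window
  have hH : ∑ i ∈ IH, ∑ V ∈ B.filter (fun V => cell V = i ∧ Q V), ω V = ∑ V ∈ B.filter Q, ω V := by
    have e : ∀ i ∈ IH, B.filter (fun V => cell V = i ∧ Q V) = (B.filter Q).filter (fun V => cell V = i) := fun i _ => by
      ext V; simp only [mem_filter]; tauto
    rw [sum_congr rfl fun i hi => by rw [e i hi]]
    exact sum_fiberwise_of_maps_to (fun V hV => hwinH V (mem_filter.1 hV).1 (mem_filter.1 hV).2) _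
  have hA : ∑ i ∈ IA, ∑ V ∈ B.filter (fun V => cell V = i ∧ ¬ Q V), ω V = ∑ V ∈ B.filter (fun V => ¬ Q V), ω V := by
    have e : ∀ i ∈ IA, B.filter (fun V => cell V = i ∧ ¬ Q V) = (B.filter fun V => ¬ Q V).filter (fun V => cell V = i) := fun i _ => by
      ext V; simp only [mem_filter]; tauto
    rw [sum_congr rfl fun i hi => by rw [e i hi]]
    exact sum_fiberwise_of_maps_to (fun V hV => hwinA V (mem_filter.1 hV).1 (mem_filter.1 hV).2) _
  have hsplit : ∑ V ∈ B.filter Q, ω V + ∑ V ∈ B.filter (fun V => ¬ Q V), ω V = 0 := by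
    rw [sum_filter_add_sum_filter_not, hω]
  rw [sum_congr rfl hXH, sum_congr rfl hXA, ← mul_sum, ← mul_sum, hH, hA, neg_mul, ← sub_eq_zero, sub_neg_eq_add, ← mul_add, hsplit, mul_zero]

/-! ## §3 HEAD — the row identity in K6-0 currency end to end -/

/-- **HEAD — «THE ABSTRACT CORE ARITHMETIC».**  Per literal `t ∈ {H, A}` and listed cell `i` (windows `IH`, `IA`): counted digit sets `S_t i`, summed LABELLED subsets `S′_t i ⊆ S_t i`,
the K6-0 law `X_t i·#S_t i = n_t i·(p_t·Σ_{S′_t i} ω)` (LH4-p18's HEAD′ per cell), ‹K6-(f) UNIFORM DENSITY› `n_t i = k·#S_t i` with ONE `k` for the row and both literals, the empty-cell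
letters `n_t i = 0 → X_t i = 0`, the sign letter `p_A = −p_H` (MECH-K3 §2), the labelled sets of all listed cells of both literals partitioning `B` (pairwise and mutually disjoint, inside
`B`, covering `B` — the short A-window is this covering), and the ONE arithmetic input `Σ_B ω = 0` ⟹ `Σ_{i ∈ IH} X_H i = Σ_{i ∈ IA} X_A i` (★ p862963's `hcore` shape at `IH = range KH`,
`IA = range KA`). [cite: Kottwitz1986BaseChangeUnits, §1 pp. 240–241] [cite: LabesseLanglands1979, §2 (2.2) p. 9] [cite: Rogawski1990, §4.9 Prop. 4.9.1 (b) p. 55] -/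
theorem sum_window_eq_sum_window_of_perCellLaw {ι α : Type*} [DecidableEq α] (B : Finset α) (IH IA : Finset ι) (SH SA S'H S'A : ι → Finset α)
    (XH XA nH nA : ι → ℤ) (ω : α → ℤ) (pH pA k : ℤ)
    (hsubH : ∀ i ∈ IH, S'H i ⊆ SH i) (hsubA : ∀ i ∈ IA, S'A i ⊆ SA i)
    (hmulH : ∀ i ∈ IH, XH i * (SH i).card = nH i * (pH * ∑ V ∈ S'H i, ω V))
    (hmulA : ∀ i ∈ IA, XA i * (SA i).card = nA i * (pA * ∑ V ∈ S'A i, ω V))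
    (hkH : ∀ i ∈ IH, nH i = k * (SH i).card) (hkA : ∀ i ∈ IA, nA i = k * (SA i).card)
    (h0H : ∀ i ∈ IH, nH i = 0 → XH i = 0) (h0A : ∀ i ∈ IA, nA i = 0 → XA i = 0) (hp : pA = -pH)
    (hHB : ∀ i ∈ IH, S'H i ⊆ B) (hAB : ∀ i ∈ IA, S'A i ⊆ B)
    (hdisjH : (IH : Set ι).PairwiseDisjoint S'H) (hdisjA : (IA : Set ι).PairwiseDisjoint S'A) (hdisjHA : ∀ i ∈ IH, ∀ i' ∈ IA, Disjoint (S'H i) (S'A i'))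
    (hcov : ∀ V ∈ B, (∃ i ∈ IH, V ∈ S'H i) ∨ (∃ i ∈ IA, V ∈ S'A i))
    (hω : ∑ V ∈ B, ω V = 0) :
    ∑ i ∈ IH, XH i = ∑ i ∈ IA, XA i := by
  refine sum_window_eq_sum_window_of_digit_partition B IH IA S'H S'A XH XA ω (k * pH) (fun i hi => ?_) (fun i hi => ?_) hHB hAB hdisjH hdisjA hdisjHA hcov hω
  · exact cellValue_eq_mul_sum_of_mul_card (SH i) (S'H i) (hsubH i hi) ω (XH i) (nH i) pH k (hmulH i hi) (hkH i hi) (h0H i hi)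
  · rw [cellValue_eq_mul_sum_of_mul_card (SA i) (S'A i) (hsubA i hi) ω (XA i) (nA i) pA k (hmulA i hi) (hkA i hi) (h0A i hi), hp]; ring

end Summit.HodgeConjecture.HodgeConjecture.Cruxes.H413.F0P3cDyRamCoreWindowOfDigitSums
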